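import Mathlib
import HarnessLib
import Literature.MathematicalPhysics.KineticTheory.VelocityFlipNoise
import Summits.AtomisticToContinuum.FouriersLaw.Theorems.VanishingNoiseTransferNoisyFourierFlipCeilingBondResponse

/-!
# Window-local observables of the pinned chain: vanishing off-window partials, invisibility to the end
thermostats, boundedness, and the growth of `X_H φ`
(helpers for stub `stub_forwardFieldLeakFree`, S2 of line `energy-dipole-leak-coercivity`, crux
stmt-AtomisticToContinuum-11976 `VanishingNoiseTransfer.VanishingNoiseBound`; `--supports` file 1/2)

A WINDOW of the `L`-site chain is a site interval `[lo, hi]`; an observable `φ : PhaseSpace L → ℝ` is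
WINDOW-LOCAL when `φ u = φ v` as soon as `u, v` agree on the coordinates `(q_k, p_k)`, `lo ≤ k ≤ hi`, and
FAR-VANISHING (at radius `R`) when `φ u = 0` as soon as one window coordinate of `u` is `≥ R` in absolute
value. Both properties are stated by the literal hypotheses of the registered stub (no definition is
introduced). Content:

* `partialP_eq_zero_of_not_window`, `partialQ_eq_zero_of_not_window`,
  `partialP_partialP_eq_zero_of_not_window` — off-window partials of a window-local `φ` vanish;
* `bathOp_bathWeight_eq_zero_of_window` — the end thermostats `S_{bathWeight}` (sites `0`, `L − 1`) do
  not see an INTERIOR window `[lo, hi] ⊆ [1, L−2]`: `S_{bathWeight} φ = 0`;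
* `windowLocal_partialQ/P`, `partialQ/P_eq_zero_of_far` — the first partials of a window-local,
  far-vanishing `φ` are window-local and far-vanishing (at radius `R + 1`);
* `exists_abs_le_of_windowLocal` — a continuous window-local far-vanishing observable is bounded (it
  factors through the compact box of radius `max R 0`);
* `abs_liouvilleOp_le_of_bounds` — `|X_H φ| ≤ C (1 + H)` when the first partials of `φ` are bounded
  (`|p_i| ≤ 1 + H`, `Σ_i |∂_{q_i} H| ≤ C_L (1 + H)`);
* `memLp_two_of_abs_le_exp_hamiltonian` — a continuous `|f| ≤ C e^{ϑH}` with `2ϑ < 1/T` is in `L²(μ_T)`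
  (adapted from `ForecastSensitivity.memLp_two_of_abs_le_exp`, which is not on this import path);
* `memLp_two_of_windowLocal` (registered helper `helper_windowLocalLiouvilleMemLp`) — the package: a `C²`
  window-local far-vanishing `φ` and `X_H φ` are in `L²(μ_T)`.

References: Bernardin–Olla 2011 §2.1; Carmona 2007 §2 (polynomial energy bounds); folklore.
-/

noncomputable section

open MeasureTheory Filter Topology Finset
open scoped ContDiff
open Literature.MathematicalPhysics.KineticTheory.HeatConduction
open Summit.AtomisticToContinuum.FouriersLaw.Theorems.SuperadditiveResistance.DeviceLiouville
  (kin liouvilleOp bathOp kin_eq_sq)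
open Summit.AtomisticToContinuum.FouriersLaw.Cruxes.SuperadditiveResistance.InsertionToolbox
  (pinnedChain_memLp_two_of_abs_le)

namespace Summit.AtomisticToContinuum.FouriersLaw.Theorems.VanishingNoiseBound

/-! ## Window-local observables: off-window partials vanish, the thermostats do not see them -/

section WindowLocal

variable {L lo hi : ℕ} {φ : PhaseSpace L → ℝ}

/-- Off-window momenta are invisible to a window-local observable: `∂_{p_i} φ = 0` for
`i ∉ [lo, hi]`. [folklore] -/
theorem partialP_eq_zero_of_not_window
    (hdep : ∀ u v : PhaseSpace L,
      (∀ k : Fin L, lo ≤ k.val → k.val ≤ hi → u.1 k = v.1 k ∧ u.2 k = v.2 k) → φ u = φ v)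
    {i : Fin L} (hiw : ¬ (lo ≤ i.val ∧ i.val ≤ hi)) (x : PhaseSpace L) : partialP i φ x = 0 := by
  unfold partialP
  have h : (fun t => φ (x.1, Function.update x.2 i t)) = fun _ => φ x := by
    funext t
    refine hdep _ _ fun k hk1 hk2 => ⟨rfl, ?_⟩
    have hki : k ≠ i := fun h => hiw (by subst h; exact ⟨hk1, hk2⟩)
    exact Function.update_of_ne hki _ _
  rw [h, deriv_const]

/-- Off-window positions are invisible to a window-local observable: `∂_{q_i} φ = 0` for
`i ∉ [lo, hi]`. [folklore] -/
theorem partialQ_eq_zero_of_not_window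
    (hdep : ∀ u v : PhaseSpace L,
      (∀ k : Fin L, lo ≤ k.val → k.val ≤ hi → u.1 k = v.1 k ∧ u.2 k = v.2 k) → φ u = φ v)
    {i : Fin L} (hiw : ¬ (lo ≤ i.val ∧ i.val ≤ hi)) (x : PhaseSpace L) : partialQ i φ x = 0 := by
  unfold partialQ
  have h : (fun t => φ (Function.update x.1 i t, x.2)) = fun _ => φ x := by
    funext t
    refine hdep _ _ fun k hk1 hk2 => ⟨?_, rfl⟩
    have hki : k ≠ i := fun h => hiw (by subst h; exact ⟨hk1, hk2⟩)
    exact Function.update_of_ne hki _ _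
  rw [h, deriv_const]

/-- `∂²_{p_i} φ = 0` off the window. [folklore] -/
theorem partialP_partialP_eq_zero_of_not_window
    (hdep : ∀ u v : PhaseSpace L,
      (∀ k : Fin L, lo ≤ k.val → k.val ≤ hi → u.1 k = v.1 k ∧ u.2 k = v.2 k) → φ u = φ v)
    {i : Fin L} (hiw : ¬ (lo ≤ i.val ∧ i.val ≤ hi)) (x : PhaseSpace L) :
    partialP i (partialP i φ) x = 0 := by
  have h : partialP i φ = fun _ => 0 := funext fun y => partialP_eq_zero_of_not_window hdep hiw y
  rw [h]
  simp [partialP]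

/-- **The end thermostats do not see an interior-window observable**: `S_{bathWeight} φ = 0` when
`[lo, hi] ⊆ [1, L−2]`. [folklore] -/
theorem bathOp_bathWeight_eq_zero_of_window
    (hdep : ∀ u v : PhaseSpace L,
      (∀ k : Fin L, lo ≤ k.val → k.val ≤ hi → u.1 k = v.1 k ∧ u.2 k = v.2 k) → φ u = φ v)
    (hlo : 1 ≤ lo) (hhi : hi + 2 ≤ L) (T : ℝ) (x : PhaseSpace L) :
    bathOp L (OscillatorChain.bathWeight L) T φ x = 0 := by
  unfold bathOp
  refine Finset.sum_eq_zero fun i _ => ?_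
  by_cases hiw : lo ≤ i.val ∧ i.val ≤ hi
  · have h0 : i.val ≠ 0 := by omega
    have h1 : i.val ≠ L - 1 := by omega
    simp [OscillatorChain.bathWeight, h0, h1]
  · rw [partialP_eq_zero_of_not_window hdep hiw, partialP_partialP_eq_zero_of_not_window hdep hiw]
    ring

/-- The position partials of a window-local observable are window-local. [folklore] -/
theorem windowLocal_partialQ
    (hdep : ∀ u v : PhaseSpace L,
      (∀ k : Fin L, lo ≤ k.val → k.val ≤ hi → u.1 k = v.1 k ∧ u.2 k = v.2 k) → φ u = φ v)
    (i : Fin L) :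
    ∀ u v : PhaseSpace L,
      (∀ k : Fin L, lo ≤ k.val → k.val ≤ hi → u.1 k = v.1 k ∧ u.2 k = v.2 k) →
        partialQ i φ u = partialQ i φ v := by
  intro u v huv
  by_cases hiw : lo ≤ i.val ∧ i.val ≤ hi
  · unfold partialQ
    rw [(huv i hiw.1 hiw.2).1]
    congr 1
    funext t
    refine hdep _ _ fun k hk1 hk2 => ⟨?_, (huv k hk1 hk2).2⟩
    by_cases hki : k = i
    · subst hki
      simp
    · show Function.update u.1 i t k = Function.update v.1 i t k
      rw [Function.update_of_ne hki, Function.update_of_ne hki, (huv k hk1 hk2).1]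
  · rw [partialQ_eq_zero_of_not_window hdep hiw, partialQ_eq_zero_of_not_window hdep hiw]

/-- The momentum partials of a window-local observable are window-local. [folklore] -/
theorem windowLocal_partialP
    (hdep : ∀ u v : PhaseSpace L,
      (∀ k : Fin L, lo ≤ k.val → k.val ≤ hi → u.1 k = v.1 k ∧ u.2 k = v.2 k) → φ u = φ v)
    (i : Fin L) :
    ∀ u v : PhaseSpace L,
      (∀ k : Fin L, lo ≤ k.val → k.val ≤ hi → u.1 k = v.1 k ∧ u.2 k = v.2 k) →
        partialP i φ u = partialP i φ v := by
  intro u v huv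
  by_cases hiw : lo ≤ i.val ∧ i.val ≤ hi
  · unfold partialP
    rw [(huv i hiw.1 hiw.2).2]
    congr 1
    funext t
    refine hdep _ _ fun k hk1 hk2 => ⟨(huv k hk1 hk2).1, ?_⟩
    by_cases hki : k = i
    · subst hki
      simp
    · show Function.update u.2 i t k = Function.update v.2 i t k
      rw [Function.update_of_ne hki, Function.update_of_ne hki, (huv k hk1 hk2).2]
  · rw [partialP_eq_zero_of_not_window hdep hiw, partialP_eq_zero_of_not_window hdep hiw]

/-- If `φ` vanishes as soon as a window coordinate is `≥ R` in size, then `∂_{q_i} φ` vanishes as soon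
as a window coordinate is `≥ R + 1` in size (there `φ ≡ 0` near the coordinate line). [folklore] -/
theorem partialQ_eq_zero_of_far {R : ℝ}
    (hvan : ∀ u : PhaseSpace L,
      (∃ k : Fin L, lo ≤ k.val ∧ k.val ≤ hi ∧ (R ≤ |u.1 k| ∨ R ≤ |u.2 k|)) → φ u = 0)
    (i : Fin L) :
    ∀ u : PhaseSpace L,
      (∃ k : Fin L, lo ≤ k.val ∧ k.val ≤ hi ∧ (R + 1 ≤ |u.1 k| ∨ R + 1 ≤ |u.2 k|)) →
        partialQ i φ u = 0 := by
  rintro u ⟨k, hk1, hk2, hk⟩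
  unfold partialQ
  have h : (fun t => φ (Function.update u.1 i t, u.2)) =ᶠ[𝓝 (u.1 i)] fun _ => 0 := by
    filter_upwards [Metric.ball_mem_nhds (u.1 i) one_pos] with t ht
    rw [Metric.mem_ball, Real.dist_eq] at ht
    refine hvan _ ⟨k, hk1, hk2, ?_⟩
    dsimp only
    rcases hk with hk | hk
    · left
      by_cases hki : k = i
      · subst hki
        rw [Function.update_self]
        have h1 := abs_sub_abs_le_abs_sub (u.1 k) t
        rw [abs_sub_comm] at h1
        linarith
      · rw [Function.update_of_ne hki]
        linarith
    · right
      linarith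
  rw [h.deriv_eq, deriv_const]

/-- The same for the momentum partials: `∂_{p_i} φ` vanishes as soon as a window coordinate is
`≥ R + 1` in size. [folklore] -/
theorem partialP_eq_zero_of_far {R : ℝ}
    (hvan : ∀ u : PhaseSpace L,
      (∃ k : Fin L, lo ≤ k.val ∧ k.val ≤ hi ∧ (R ≤ |u.1 k| ∨ R ≤ |u.2 k|)) → φ u = 0)
    (i : Fin L) :
    ∀ u : PhaseSpace L,
      (∃ k : Fin L, lo ≤ k.val ∧ k.val ≤ hi ∧ (R + 1 ≤ |u.1 k| ∨ R + 1 ≤ |u.2 k|)) →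
        partialP i φ u = 0 := by
  rintro u ⟨k, hk1, hk2, hk⟩
  unfold partialP
  have h : (fun t => φ (u.1, Function.update u.2 i t)) =ᶠ[𝓝 (u.2 i)] fun _ => 0 := by
    filter_upwards [Metric.ball_mem_nhds (u.2 i) one_pos] with t ht
    rw [Metric.mem_ball, Real.dist_eq] at ht
    refine hvan _ ⟨k, hk1, hk2, ?_⟩
    dsimp only
    rcases hk with hk | hk
    · left
      linarith
    · right
      by_cases hki : k = i
      · subst hki
        rw [Function.update_self]
        have h1 := abs_sub_abs_le_abs_sub (u.2 k) t
        rw [abs_sub_comm] at h1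
        linarith
      · rw [Function.update_of_ne hki]
        linarith
  rw [h.deriv_eq, deriv_const]

/-- **Window-local observables that vanish far out are bounded.** A continuous `ψ` that depends only on
the window coordinates and vanishes as soon as one of them is `≥ R` in size factors through the compact
box `{all coordinates ≤ max R 0}` (zero the off-window coordinates), so `|ψ| ≤ M`. [folklore] -/
theorem exists_abs_le_of_windowLocal {ψ : PhaseSpace L → ℝ} (hψ : Continuous ψ)
    (hdep : ∀ u v : PhaseSpace L,
      (∀ k : Fin L, lo ≤ k.val → k.val ≤ hi → u.1 k = v.1 k ∧ u.2 k = v.2 k) → ψ u = ψ v)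
    {R : ℝ} (hvan : ∀ u : PhaseSpace L,
      (∃ k : Fin L, lo ≤ k.val ∧ k.val ≤ hi ∧ (R ≤ |u.1 k| ∨ R ≤ |u.2 k|)) → ψ u = 0) :
    ∃ M : ℝ, 0 ≤ M ∧ ∀ x, |ψ x| ≤ M := by
  set R₀ := max R 0 with hR₀
  have hK : IsCompact (Metric.closedBall (0 : PhaseSpace L) R₀) := isCompact_closedBall 0 R₀
  obtain ⟨M, hM⟩ := hK.exists_bound_of_continuousOn hψ.continuousOn
  refine ⟨max M 0, le_max_right _ _, fun x => ?_⟩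
  by_cases hx : ∃ k : Fin L, lo ≤ k.val ∧ k.val ≤ hi ∧ (R ≤ |x.1 k| ∨ R ≤ |x.2 k|)
  · rw [hvan x hx, abs_zero]
    exact le_max_right _ _
  · push Not at hx
    set y : PhaseSpace L := (fun k => if lo ≤ k.val ∧ k.val ≤ hi then x.1 k else 0,
      fun k => if lo ≤ k.val ∧ k.val ≤ hi then x.2 k else 0) with hy
    have hxy : ψ x = ψ y := hdep x y fun k hk1 hk2 => by
      simp only [hy, if_pos (And.intro hk1 hk2), and_self]
    have hyK : y ∈ Metric.closedBall (0 : PhaseSpace L) R₀ := by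
      rw [Metric.mem_closedBall, dist_zero_right, Prod.norm_def, max_le_iff,
        pi_norm_le_iff_of_nonneg (le_max_right R 0), pi_norm_le_iff_of_nonneg (le_max_right R 0)]
      refine ⟨fun k => ?_, fun k => ?_⟩
      · simp only [hy]
        split_ifs with h
        · rw [Real.norm_eq_abs]
          exact (hx k h.1 h.2).1.le.trans (le_max_left _ _)
        · rw [norm_zero]
          exact le_max_right _ _
      · simp only [hy]
        split_ifs with h
        · rw [Real.norm_eq_abs]
          exact (hx k h.1 h.2).2.le.trans (le_max_left _ _)
        · rw [norm_zero]
          exact le_max_right _ _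
    rw [hxy, ← Real.norm_eq_abs]
    exact (hM y hyK).trans (le_max_left _ _)

end WindowLocal

/-! ## Growth of `X_H φ` for bounded gradients; `L²(μ_T)` from an exponential bound -/

section Growth

variable {ω₂ lam β : ℝ} {L : ℕ}

/-- **`|X_H φ| ≤ C (1 + H)` for an observable with bounded first partials** (pinned chain, `ω₂ > 0`,
`lam, β ≥ 0`): `|p_i| ≤ 1 + H` and `Σ_i |∂_{q_i} H| ≤ C_L (1 + H)` (`pinnedChain_sum_abs_partialQ_le`).
[folklore] -/
theorem abs_liouvilleOp_le_of_bounds (hω : 0 < ω₂) (hl : 0 ≤ lam) (hβ : 0 ≤ β) (γ : ℝ)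
    {φ : PhaseSpace L → ℝ} {Mq Mp : ℝ} (hMp : 0 ≤ Mp)
    (hq : ∀ i x, |partialQ i φ x| ≤ Mq) (hp : ∀ i x, |partialP i φ x| ≤ Mp) (x : PhaseSpace L) :
    |liouvilleOp (pinnedChain ω₂ lam β γ) L φ x| ≤
      ((L : ℝ) * Mq + (L : ℝ) * (ω₂ / 2 + 3 + lam / ω₂ + (L : ℝ) ^ 2 * (3 + β)) * Mp) *
        (1 + (pinnedChain ω₂ lam β γ).hamiltonian L x) ^ 1 := by
  set H := (pinnedChain ω₂ lam β γ).hamiltonian L x with hH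
  have hH0 : 0 ≤ H := pinnedChain_hamiltonian_nonneg hω.le hl hβ γ L x
  have hU0 : ∀ q, 0 ≤ (pinnedChain ω₂ lam β γ).U q := fun q => by
    show 0 ≤ ω₂ * q ^ 2 / 2 + lam * q ^ 4 / 4
    positivity
  have hV0 : ∀ r, 0 ≤ (pinnedChain ω₂ lam β γ).V r := fun r => by
    show 0 ≤ r ^ 2 / 2 + β * r ^ 4 / 4
    positivity
  have hpi : ∀ i, |x.2 i| ≤ 1 + H := fun i => by
    have h1 := (pinnedChain ω₂ lam β γ).site_le_hamiltonian hU0 hV0 L x i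
    have h2 := hU0 (x.1 i)
    nlinarith [sq_abs (x.2 i), sq_nonneg (|x.2 i| - 1), abs_nonneg (x.2 i)]
  have hsum := pinnedChain_sum_abs_partialQ_le hω hl hβ γ L x
  set CH := (L : ℝ) * (ω₂ / 2 + 3 + lam / ω₂ + (L : ℝ) ^ 2 * (3 + β)) with hCH
  have hterm : ∀ i, |x.2 i * partialQ i φ x -
      partialQ i ((pinnedChain ω₂ lam β γ).hamiltonian L) x * partialP i φ x| ≤
      (1 + H) * Mq + |partialQ i ((pinnedChain ω₂ lam β γ).hamiltonian L) x| * Mp := fun i => by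
    refine (abs_sub _ _).trans ?_
    rw [abs_mul, abs_mul]
    exact add_le_add (mul_le_mul (hpi i) (hq i x) (abs_nonneg _) (by linarith))
      (mul_le_mul_of_nonneg_left (hp i x) (abs_nonneg _))
  unfold liouvilleOp
  calc |∑ i, (x.2 i * partialQ i φ x -
          partialQ i ((pinnedChain ω₂ lam β γ).hamiltonian L) x * partialP i φ x)|
      ≤ ∑ i, |x.2 i * partialQ i φ x -
          partialQ i ((pinnedChain ω₂ lam β γ).hamiltonian L) x * partialP i φ x| :=
        Finset.abs_sum_le_sum_abs _ _
    _ ≤ ∑ i, ((1 + H) * Mq + |partialQ i ((pinnedChain ω₂ lam β γ).hamiltonian L) x| * Mp) :=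
        Finset.sum_le_sum fun i _ => hterm i
    _ = (L : ℝ) * ((1 + H) * Mq) +
          (∑ i, |partialQ i ((pinnedChain ω₂ lam β γ).hamiltonian L) x|) * Mp := by
        rw [Finset.sum_add_distrib, Finset.sum_const, Finset.card_univ, Fintype.card_fin,
          nsmul_eq_mul, Finset.sum_mul]
    _ ≤ (L : ℝ) * ((1 + H) * Mq) + (CH * (1 + H)) * Mp :=
        add_le_add le_rfl (mul_le_mul_of_nonneg_right hsum hMp)
    _ = ((L : ℝ) * Mq + CH * Mp) * (1 + H) ^ 1 := by ring

/-- A continuous `e^{ϑH}`-dominated observable is in `L²(μ_T)` when `2ϑ < 1/T` (pinned chain, `T > 0`).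
[folklore] -/
theorem memLp_two_of_abs_le_exp_hamiltonian (hω : 0 < ω₂) (hl : 0 ≤ lam) (hβ : 0 ≤ β) (γ : ℝ)
    (L : ℕ) {T : ℝ} (hT : 0 < T) {ϑ C : ℝ} (h2ϑ : 2 * ϑ < 1 / T) {f : PhaseSpace L → ℝ}
    (hf : Continuous f)
    (hfb : ∀ x, |f x| ≤ C * Real.exp (ϑ * (pinnedChain ω₂ lam β γ).hamiltonian L x)) :
    MemLp f 2 ((pinnedChain ω₂ lam β γ).gibbsMeasure L T) := by
  -- adapted from `ForecastSensitivity.memLp_two_of_abs_le_exp` (…ConductanceLowerBoundStubKuboLinkAux5)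
  set w : PhaseSpace L → ℝ := fun z => C * Real.exp (ϑ * (pinnedChain ω₂ lam β γ).hamiltonian L z) with hw
  have hwc : Continuous w := continuous_const.mul (Real.continuous_exp.comp
    (continuous_const.mul (pinnedChain_continuous_hamiltonian ω₂ lam β γ L)))
  have hw2 : MemLp w 2 ((pinnedChain ω₂ lam β γ).gibbsMeasure L T) := by
    refine (memLp_two_iff_integrable_sq hwc.aestronglyMeasurable).2 ?_
    have h2 := pinnedChain_integrable_exp_mul_hamiltonian_gibbsMeasure hω hl hβ γ L hT h2ϑ
    refine (h2.const_mul (C ^ 2)).congr (Eventually.of_forall fun z => ?_)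
    simp only [hw]
    rw [mul_pow, sq (Real.exp _), ← Real.exp_add]
    ring_nf
  refine hw2.mono' hf.aestronglyMeasurable (Eventually.of_forall fun z => ?_)
  rw [Real.norm_eq_abs]
  exact hfb z

end Growth

/-! ## Package: a smooth window-local far-vanishing observable and its `X_H` are in `L²(μ_T)` -/

section Package

variable {ω₂ lam β : ℝ} {L : ℕ}

/-- **`φ, X_H φ ∈ L²(μ_T)` for a `C²` window-local far-vanishing observable** (pinned chain, `ω₂ > 0`,
`lam, β ≥ 0`, `T > 0`): `φ` and its first partials are bounded (`exists_abs_le_of_windowLocal` applied to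
`φ`, `∂_{q_i} φ`, `∂_{p_i} φ`), so `|φ| ≤ M` and `|X_H φ| ≤ C (1 + H)` (`abs_liouvilleOp_le_of_bounds`), and
polynomially bounded continuous observables are in `L²(μ_T)` (`pinnedChain_memLp_two_of_abs_le`).
[folklore] -/
theorem memLp_two_of_windowLocal (hω : 0 < ω₂) (hl : 0 ≤ lam) (hβ : 0 ≤ β) (γ : ℝ) {T : ℝ}
    (hT : 0 < T) {lo hi : ℕ} {φ : PhaseSpace L → ℝ} (hφ : ContDiff ℝ 2 φ)
    (hdep : ∀ u v : PhaseSpace L,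
      (∀ k : Fin L, lo ≤ k.val → k.val ≤ hi → u.1 k = v.1 k ∧ u.2 k = v.2 k) → φ u = φ v)
    (hvan : ∃ R : ℝ, ∀ u : PhaseSpace L,
      (∃ k : Fin L, lo ≤ k.val ∧ k.val ≤ hi ∧ (R ≤ |u.1 k| ∨ R ≤ |u.2 k|)) → φ u = 0) :
    MemLp φ 2 ((pinnedChain ω₂ lam β γ).gibbsMeasure L T) ∧
      MemLp (liouvilleOp (pinnedChain ω₂ lam β γ) L φ) 2 ((pinnedChain ω₂ lam β γ).gibbsMeasure L T) := by
  have hφ1 : ContDiff ℝ 1 φ := hφ.of_le (by norm_cast)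
  obtain ⟨R, hR⟩ := hvan
  obtain ⟨M₀, -, hM₀⟩ := exists_abs_le_of_windowLocal hφ.continuous hdep hR
  have hbq : ∀ i : Fin L, ∃ M : ℝ, 0 ≤ M ∧ ∀ x, |partialQ i φ x| ≤ M := fun i =>
    exists_abs_le_of_windowLocal (continuous_partialQ hφ1 one_ne_zero i) (windowLocal_partialQ hdep i)
      (partialQ_eq_zero_of_far hR i)
  have hbp : ∀ i : Fin L, ∃ M : ℝ, 0 ≤ M ∧ ∀ x, |partialP i φ x| ≤ M := fun i =>
    exists_abs_le_of_windowLocal (continuous_partialP hφ1 one_ne_zero i) (windowLocal_partialP hdep i)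
      (partialP_eq_zero_of_far hR i)
  choose Mq hMq0 hMq using hbq
  choose Mp hMp0 hMp using hbp
  have hq : ∀ i x, |partialQ i φ x| ≤ ∑ j, Mq j := fun i x =>
    (hMq i x).trans (Finset.single_le_sum (f := Mq) (fun j _ => hMq0 j) (Finset.mem_univ i))
  have hp : ∀ i x, |partialP i φ x| ≤ ∑ j, Mp j := fun i x =>
    (hMp i x).trans (Finset.single_le_sum (f := Mp) (fun j _ => hMp0 j) (Finset.mem_univ i))
  refine ⟨pinnedChain_memLp_two_of_abs_le hω hl hβ γ L hT hφ.continuous (C := M₀) (k := 0) fun x => by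
      rw [pow_zero, mul_one]; exact hM₀ x, ?_⟩
  exact pinnedChain_memLp_two_of_abs_le hω hl hβ γ L hT
    (SuperadditiveResistance.Kubo.continuous_liouvilleOp L hφ)
    (abs_liouvilleOp_le_of_bounds hω hl hβ γ (Finset.sum_nonneg fun j _ => hMp0 j) hq hp)

end Package

/-! ## Registered helper sub-goal (stub form, one line) -/

/-- Registered helper sub-goal `helper_windowLocalLiouvilleMemLp` of stub `stub_forwardFieldLeakFree`
(= `memLp_two_of_windowLocal` in stub form): a `C²` window-local far-vanishing observable `φ` of the pinned
chain and its Hamiltonian derivative `X_H φ` are in `L²(μ_T)`. [folklore] -/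
theorem helper_windowLocalLiouvilleMemLp : ∀ (ω₂ lam β γ : ℝ), 0 < ω₂ → 0 ≤ lam → 0 ≤ β → ∀ (L : ℕ) (T : ℝ), 0 < T → ∀ (lo hi : ℕ) (φ : Literature.MathematicalPhysics.KineticTheory.HeatConduction.PhaseSpace L → ℝ), ContDiff ℝ 2 φ → (∀ u v : Literature.MathematicalPhysics.KineticTheory.HeatConduction.PhaseSpace L, (∀ k : Fin L, lo ≤ k.val → k.val ≤ hi → u.1 k = v.1 k ∧ u.2 k = v.2 k) → φ u = φ v) → (∃ R : ℝ, ∀ u : Literature.MathematicalPhysics.KineticTheory.HeatConduction.PhaseSpace L, (∃ k : Fin L, lo ≤ k.val ∧ k.val ≤ hi ∧ (R ≤ |u.1 k| ∨ R ≤ |u.2 k|)) → φ u = 0) → MeasureTheory.MemLp φ 2 ((Literature.MathematicalPhysics.KineticTheory.HeatConduction.pinnedChain ω₂ lam β γ).gibbsMeasure L T) ∧ MeasureTheory.MemLp (Summit.AtomisticToContinuum.FouriersLaw.Theorems.SuperadditiveResistance.DeviceLiouville.liouvilleOp (Literature.MathematicalPhysics.KineticTheory.HeatConduction.pinnedChain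 ω₂ lam β γ) L φ) 2 ((Literature.MathematicalPhysics.KineticTheory.HeatConduction.pinnedChain ω₂ lam β γ).gibbsMeasure L T) :=
  fun _ _ _ γ hω hl hβ _ _ hT _ _ _ hφ hdep hvan => memLp_two_of_windowLocal hω hl hβ γ hT hφ hdep hvan

end Summit.AtomisticToContinuum.FouriersLaw.Theorems.VanishingNoiseBound

end
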